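import Summits.QuantumFields.BalabanUV.Beta.GAN24.StencilSlotSAllThree
import Summits.QuantumFields.BalabanUV.Beta.GAN24.StencilSlotWallPlug
import Summits.QuantumFields.BalabanUV.Beta.GAN24.TaylorRowDWThree
import Summits.QuantumFields.BalabanUV.Beta.GAN24.S3DiffV
import Summits.QuantumFields.BalabanUV.Beta.GAN24.S3DiffL

/-!
# `BalabanUV.Beta.GAN24.StencilSlotWallThree` — binder row G-an2-4 / (CONV-C) at the D1 WALL, `d = 3`, `Lc ≥ 2`: THE WALL ⟺ THE IDENTIFICATION
# FROM THE THREE IN-FLIGHT DIFFERENCE ROWS `dW`, `dV`, `dL` AND an2's TWO W-ROWS ALONE (row owner b2b-balaban-gan24-p1, gen 4; carver (C17) couriered)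

NOT IN PRINT; OUR PROOF ATTEMPT.  HONEST FRAMING (cell contract, verbatim): «discharging `BetaPertH` makes Bałaban's UV stability
UNCONDITIONAL — a real constructive-QFT result; it is NOT the continuum limit and NOT the Clay problem.»  HONEST DEPENDENCY (verbatim):
«continuum YM on T⁴ ⇐ BetaPertH ∧ nine spine estimates (0/9 proved); BetaPertH ⇐ (D1) ∧ (D4) ∧ CAP+tail; G-an2-4 gates asym, D1 and
NE2/3/4.»

WHAT.  asym1's wall theorem `HessKerConvCKPlug.d1Drift_JsBalOf_iff_of_convCKWall` turns the D1 wall for the Bałaban jets `JsBalOf` into the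
identification `secondMoment (dressed limit kernels) μ ν = stepBal N Lc`, given four binder families: the K-rows (tree theorems since gen 3,
`KSlotAssembly.convCKWall_holds`), the S-rows `(hS, hSall)` and an2's W-rows `(hW, hWall)`.  With the S-slot countdown of `StencilSlotSAllThree` (nine of
the twelve analytic rows of road «S3» landed BY NAME), this module states the countdown AT THE WALL: `d1Drift_JsBalOf_iff_three_of_diffRows` — the wall
⟺ the identification follows from the THREE in-flight DIFFERENCE rows `dW`, `dV`, `dL` (each ∃-packaged at its own ratios, texts verbatim from
`StencilSlotRowsMerge.hS_hSall_of_rows_indep`) and an2's two W-rows in dressed units (`hW₂`, `hW₂all`, road P4) ALONE.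

HOW ([folklore] composition, every input BY NAME): the nine landed rows (`TaylorRowW.rowW_three`, `S3RowV0.shapeV0`, `S3ShapeL0.rowL0_shape`,
`S3ShapeVt.shapeVt_three`, `TaylorRowLamTop.rowLamTop`, `TaylorRowV.rowV_three`, `TaylorRowLam.rowL_three`, `TopBorderKSlot.diffVt_three`, `S3DiffLt.diffLt_three`)
+ the three hypotheses → `StencilSlotRowsMerge.rows_merge` (common scalars) → `StencilSlotE3Tables.e3Shape_and_drift_of_rows` («E3Shape» ∧ «E3Drift») →
`StencilSlotWallPlug.d1Drift_JsBalOf_iff_of_e3Shapes` (leaf-06's plug over asym1's wall; K-slot inside).  This is the FORMAL-swarm CARVER's (C17)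
`d1Drift_JsBalOf_iff_of_rows_indep` (probe «ROWS-MERGE» v1 §2, a87d45d74d511c4a) with the nine landed rows inserted; couriered by the row owner.

HONEST: conditional on `dW`, `dV`, `dL` (holders leaf-15, leaf-03, leaf-11) and on an2's W-rows; discharges nothing new by itself; NOT «G-an2-4 closed»,
NOT (CONV-C); NOT BetaPertH, NOT continuum, NOT Clay.
-/

noncomputable section

open Literature.MathematicalPhysics.QuantumFieldTheory
open Literature.MathematicalPhysics.QuantumFieldTheory.Balaban1983to89
open Literature.MathematicalPhysics.QuantumFieldTheory.Balaban1983to89.Beta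
open ExpKernelCalculus (MKer VertexFamily₂ hessKer)
open OneStepResolventKernel (Fib LocStencil)
open OneStepKernelFamily (KInvStep D1Drift)
open AxialDressing (axDressK axVertexOfK)
open StepJetData (wilsonA)
open BalabanCompositeJets (pushSum borderInc lagrInc)
open BalabanStepJetsSucc (JsBal0Of JsBalOf)
open HessKerDressedLimit (limMKerOf limStOf limTabOf)
open Summit.QuantumFields.BalabanUV.Beta.HessKerDressedUnits (unitK unitS unitW)
open Summit.QuantumFields.BalabanUV.Beta.GAN24.CombesThomas (SupBound sfStep smStep)
open Summit.QuantumFields.BalabanUV.Beta.GAN24.E3UnitSplit (e3OfS)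
open Summit.QuantumFields.BalabanUV.Beta.GAN24.StencilSlotOfE3 (one_le_of_two_le)
open Summit.QuantumFields.BalabanUV.Beta.GAN24.StencilSlotE3Tables (e3Shape_and_drift_of_rows)
open Summit.QuantumFields.BalabanUV.Beta.GAN24.StencilSlotRowsMerge (rows_merge)
open Summit.QuantumFields.BalabanUV.Beta.GAN24.StencilSlotSThree (inv_Lc_ratio)
open Summit.QuantumFields.BalabanUV.Beta.GAN24.StencilSlotWallPlug (d1Drift_JsBalOf_iff_of_e3Shapes)

namespace Summit.QuantumFields.BalabanUV.Beta.GAN24.StencilSlotWallThree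

variable {Lc : ℕ} [NeZero Lc]

/-- **THE D1 WALL ⟺ THE IDENTIFICATION AT `d = 3`, `Lc ≥ 2`, FROM `dW`, `dV`, `dL` AND an2's TWO W-ROWS ALONE** (carver (C17) with the nine landed
rows of road «S3» inserted by name). [folklore] composition. -/
theorem d1Drift_JsBalOf_iff_three_of_diffRows (hLc : 2 ≤ Lc) (cE cVH cΛ : ℝ)
    (dW : ∃ eW θ : ℝ, 0 ≤ θ ∧ θ < 1 ∧ ∀ (n : ℕ) (κ' : Fin (3 + 1)) (u' : Fin (3 + 1) → ℤ), SupBound (fun x z a b =>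
      ((Lc : ℝ) ^ (n + 1 + 1 + 1)) ^ (2 * (3 + 1)) * e3OfS (Lc ^ (n + 1 + 1 + 1)) (fun κ u => (cE * ((Lc : ℝ) ^ (3 + 1)) ^ (n + 1 + 1)) • wilsonA 3 κ u) κ' u' x z a b -
      ((Lc : ℝ) ^ (n + 1 + 1)) ^ (2 * (3 + 1)) * e3OfS (Lc ^ (n + 1 + 1)) (fun κ u => (cE * ((Lc : ℝ) ^ (3 + 1)) ^ (n + 1)) • wilsonA 3 κ u) κ' u' x z a b) (eW * θ ^ (n + 1)))
    (dV : ∃ eV θ ρ : ℝ, 0 ≤ θ ∧ θ < 1 ∧ 0 ≤ ρ ∧ ρ < 1 ∧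
      ∀ (n m : ℕ), m < n → ∀ (κ' : Fin (3 + 1)) (u' : Fin (3 + 1) → ℤ), SupBound (fun x z a b =>
      ((Lc : ℝ) ^ (n + 1 + 1 + 1)) ^ (2 * (3 + 1)) * e3OfS (Lc ^ (n + 1 + 1 + 1)) (fun κ u => ((((Lc : ℝ) ^ (3 + 1)) ^ (n - m) * (cVH * ((Lc : ℝ) ^ (m + 1 + 1)) ^ (3 + 2))) •
        pushSum (Lc ^ (m + 1 + 1 + 1)) (Lc ^ (n - m)) (borderInc 3 Lc (Lc ^ (m + 1 + 1)) κ u))) κ' u' x z a b -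
      ((Lc : ℝ) ^ (n + 1 + 1)) ^ (2 * (3 + 1)) * e3OfS (Lc ^ (n + 1 + 1)) (fun κ u => ((((Lc : ℝ) ^ (3 + 1)) ^ (n - m) * (cVH * ((Lc : ℝ) ^ (m + 1)) ^ (3 + 2))) •
        pushSum (Lc ^ (m + 1 + 1)) (Lc ^ (n - m)) (borderInc 3 Lc (Lc ^ (m + 1)) κ u))) κ' u' x z a b) (eV * θ ^ (n + 1) * ρ ^ (n - m)))
    (dL : ∃ eL θ ρ : ℝ, 0 ≤ θ ∧ θ < 1 ∧ 0 ≤ ρ ∧ ρ < 1 ∧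
      ∀ (n m : ℕ), m < n → ∀ (κ' : Fin (3 + 1)) (u' : Fin (3 + 1) → ℤ), SupBound (fun x z a b =>
      ((Lc : ℝ) ^ (n + 1 + 1 + 1)) ^ (2 * (3 + 1)) * e3OfS (Lc ^ (n + 1 + 1 + 1)) (fun κ u => ((((Lc : ℝ) ^ (3 + 1)) ^ (n - m) * (cΛ * ((Lc : ℝ) ^ (m + 1 + 1)) ^ (2 * 3 + 4))) •
        lagrInc 3 Lc (Lc ^ (m + 1 + 1)) (Lc ^ (m + 1 + 1 + 1)) κ u)) κ' u' x z a b -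
      ((Lc : ℝ) ^ (n + 1 + 1)) ^ (2 * (3 + 1)) * e3OfS (Lc ^ (n + 1 + 1)) (fun κ u => ((((Lc : ℝ) ^ (3 + 1)) ^ (n - m) * (cΛ * ((Lc : ℝ) ^ (m + 1)) ^ (2 * 3 + 4))) •
        lagrInc 3 Lc (Lc ^ (m + 1)) (Lc ^ (m + 1 + 1)) κ u)) κ' u' x z a b) (eL * θ ^ (n + 1) * ρ ^ (n - m)))
    (W : ℕ → Fin (3 + 1) → (Fin (3 + 1) → ℤ) → Fin (3 + 1) → (Fin (3 + 1) → ℤ) → MKer (3 + 1) (Fib 3))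
    (Cw δw : ℕ → ℝ) (hδw : ∀ j, 0 < δw j) (hW' : ∀ j, VertexFamily₂ (W j) Lc (Cw j) (δw j))
    {Cw₂ cW δW θW : ℝ}
    (hW₂ : ∀ j, VertexFamily₂ (unitW (sfStep Lc j) (smStep 3 Lc j) (W j)) Lc Cw₂ δW)
    (hW₂all : ∀ k j, VertexFamily₂ (unitW (sfStep Lc (k + j)) (smStep 3 Lc (k + j)) (W (k + j)) -
      unitW (sfStep Lc k) (smStep 3 Lc k) (W k)) Lc (cW * θW ^ k) δW)
    (hδW : 0 < δW) (hθW0 : 0 ≤ θW) (hθW1 : θW < 1) (μ ν : Fin 4) (N : ℝ) :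
    D1Drift Lc (JsBalOf (one_le_of_two_le hLc) cE cVH cΛ W Cw δw hδw hW') N μ ν ↔
      B12Beta.secondMoment (hessKer (axDressK Lc (limMKerOf fun j => unitK (sfStep Lc j) (smStep 3 Lc j) (KInvStep (d := 3) Lc j)))
        (axVertexOfK (limMKerOf fun j => unitK (sfStep Lc j) (smStep 3 Lc j) (KInvStep (d := 3) Lc j)) Lc
          (limStOf fun j => unitS (sfStep Lc j) (smStep 3 Lc j) (JsBal0Of (one_le_of_two_le hLc) cE cVH cΛ W Cw δw hδw hW' j).S))
        (limTabOf fun j => unitW (sfStep Lc j) (smStep 3 Lc j) (W j))) μ ν = B12Normalization.stepBal N Lc := by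
  have hLc1 : 1 ≤ Lc := one_le_of_two_le hLc
  obtain ⟨hι0, hι1⟩ := inv_Lc_ratio (Lc := Lc) hLc
  obtain ⟨c₀V, δ₂, -, hδ₂, hV0⟩ := S3RowV0.shapeV0 (Lc := Lc) hLc1 cVH
  obtain ⟨c₀L, θ₃', δ₃', -, hθ₃0, hθ₃1', hδ₃', hL0⟩ := S3ShapeL0.rowL0_shape (Lc := Lc) hLc cΛ
  obtain ⟨cV, θ₆, δ₆, -, hθ₆0, hθ₆1, hδ₆, hV⟩ := TaylorRowV.rowV_three (Lc := Lc) hLc cVH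
  obtain ⟨cL, δ₇, hδ₇, hL⟩ := TaylorRowLam.rowL_three (Lc := Lc) cΛ
  obtain ⟨cLt, θ₁₀, -, hθ₁₀0, hθ₁₀1, dLt⟩ := S3DiffLt.diffLt_three (Lc := Lc) hLc cΛ
  obtain ⟨δ, θ, ρ, CW, c₀V', c₀L', CtV, CtL, cV', cL', eW, eVt, eLt, eV, eL, hδ, hθ0, hθ1, hρ0, hρ1,
      h₁, h₂, h₃, h₄, h₅, h₆, h₇, h₈, h₉, h₁₀, h₁₁, h₁₂⟩ :=
    rows_merge (d := 3) (TaylorRowW.rowW_three (Lc := Lc) cE) ⟨c₀V, (Lc : ℝ)⁻¹, δ₂, hδ₂, hι0, hι1, hV0⟩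
      ⟨c₀L, θ₃', δ₃', hδ₃', hθ₃0, hθ₃1', hL0⟩ (S3ShapeVt.shapeVt_three (Lc := Lc) hLc1 cVH) (TaylorRowLamTop.rowLamTop (Lc := Lc) hLc1 cΛ)
      ⟨cV, θ₆, δ₆, hδ₆, hθ₆0, hθ₆1, hV⟩ ⟨cL, (Lc : ℝ)⁻¹, δ₇, hδ₇, hι0, hι1, hL⟩ dW (TopBorderKSlot.diffVt_three (Lc := Lc) hLc cVH)
      ⟨cLt, θ₁₀, hθ₁₀0, hθ₁₀1, dLt⟩ dV dL
  obtain ⟨C₃, c₃, θ₃, δ₃, hθ₃, hθ₃1, hδ₃, hE3, hE3d⟩ :=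
    e3Shape_and_drift_of_rows (d := 3) hLc1 cE cVH cΛ hδ hθ0 hθ1 hρ0 hρ1 h₁ h₂ h₃ h₄ h₅ h₆ h₇ h₈ h₉ h₁₀ h₁₁ h₁₂
  exact d1Drift_JsBalOf_iff_of_e3Shapes hLc cE cVH cΛ W Cw δw hδw hW' hE3 hE3d hθ₃ hθ₃1 hδ₃ hW₂ hW₂all hδW hθW0 hθW1 μ ν N

/-! ## v1.1 APPENDIX (gen 5): the three DIFFERENCE rows landed — the wall ⟺ the identification from an2's TWO W-ROWS ALONE (`d = 3`, `Lc ≥ 2`) -/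

/-- **THE D1 WALL ⟺ THE IDENTIFICATION AT `d = 3`, `Lc ≥ 2`, FROM an2's TWO W-ROWS ALONE.**  For the Bałaban jets `JsBalOf` (an2's W-slot data
`(W, Cw, δw, hδw, hW')` NAME the jets), asym1's wall theorem `HessKerConvCKPlug.d1Drift_JsBalOf_iff_of_convCKWall` needs four binder families
`hK hKall hS hSall hW hWall`; the K-rows are tree theorems since gen 3 (`KSlotAssembly.convCKWall_holds`) and the S-rows since the twelve analytic rows
of road «S3» landed (`StencilSlotSAllThree.hS_hSall_three`).  Hence the wall ⟺ the identification `secondMoment (dressed limit kernels) μ ν = stepBal N Lc`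
given ONLY an2's two W-rows in dressed units (`hW₂`, `hW₂all` with their rate data `0 < δW`, `0 ≤ θW < 1`; road P4).  Proof:
`d1Drift_JsBalOf_iff_three_of_diffRows` fed BY NAME with dW = `TaylorRowDWThree.rowDW_three` (leaf-15 over leaf-19's block-sample form of «(N1-Cauchy)»
over leaf-17's team END, PART A leaf-16), dV = `S3DiffV.diffV_three` (leaf-03; its surplus conjunct `0 ≤ cV` dropped), dL = `S3DiffL.diffL_three`
(leaf-11; `SandwichDecimate*` leaf-04).  HONEST: conditional on an2's W-rows (the W-slot: hW ⇐ «T2Shape» ∧ mixed-table shape by leaf-07's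
`WSlotOfShapes`/`WSlotThree`, hWall ⇐ hW ∧ W-sup-rate by leaf-01's `WSlotSupRate` — «T2Shape» and the W-sup-rate OPEN) and the identification is the
D1 wall, not (D1); NOT «G-an2-4 closed», NOT (CONV-C); NOT BetaPertH, NOT continuum, NOT Clay. [folklore] composition. -/
theorem d1Drift_JsBalOf_iff_three_of_wRows (hLc : 2 ≤ Lc) (cE cVH cΛ : ℝ)
    (W : ℕ → Fin (3 + 1) → (Fin (3 + 1) → ℤ) → Fin (3 + 1) → (Fin (3 + 1) → ℤ) → MKer (3 + 1) (Fib 3))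
    (Cw δw : ℕ → ℝ) (hδw : ∀ j, 0 < δw j) (hW' : ∀ j, VertexFamily₂ (W j) Lc (Cw j) (δw j))
    {Cw₂ cW δW θW : ℝ}
    (hW₂ : ∀ j, VertexFamily₂ (unitW (sfStep Lc j) (smStep 3 Lc j) (W j)) Lc Cw₂ δW)
    (hW₂all : ∀ k j, VertexFamily₂ (unitW (sfStep Lc (k + j)) (smStep 3 Lc (k + j)) (W (k + j)) -
      unitW (sfStep Lc k) (smStep 3 Lc k) (W k)) Lc (cW * θW ^ k) δW)
    (hδW : 0 < δW) (hθW0 : 0 ≤ θW) (hθW1 : θW < 1) (μ ν : Fin 4) (N : ℝ) :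
    D1Drift Lc (JsBalOf (one_le_of_two_le hLc) cE cVH cΛ W Cw δw hδw hW') N μ ν ↔
      B12Beta.secondMoment (hessKer (axDressK Lc (limMKerOf fun j => unitK (sfStep Lc j) (smStep 3 Lc j) (KInvStep (d := 3) Lc j)))
        (axVertexOfK (limMKerOf fun j => unitK (sfStep Lc j) (smStep 3 Lc j) (KInvStep (d := 3) Lc j)) Lc
          (limStOf fun j => unitS (sfStep Lc j) (smStep 3 Lc j) (JsBal0Of (one_le_of_two_le hLc) cE cVH cΛ W Cw δw hδw hW' j).S))
        (limTabOf fun j => unitW (sfStep Lc j) (smStep 3 Lc j) (W j))) μ ν = B12Normalization.stepBal N Lc := by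
  -- dW and dL in the binder packaging verbatim; dV: drop `0 ≤ cV`
  obtain ⟨cV, θ₁₁, ρ₁₁, -, hθ₁₁0, hθ₁₁1, hρ₁₁0, hρ₁₁1, dV⟩ := S3DiffV.diffV_three (Lc := Lc) hLc cVH
  exact d1Drift_JsBalOf_iff_three_of_diffRows hLc cE cVH cΛ (TaylorRowDWThree.rowDW_three (Lc := Lc) hLc cE)
    ⟨cV, θ₁₁, ρ₁₁, hθ₁₁0, hθ₁₁1, hρ₁₁0, hρ₁₁1, dV⟩ (S3DiffL.diffL_three (Lc := Lc) hLc cΛ) W Cw δw hδw hW' hW₂ hW₂all hδW hθW0 hθW1 μ ν N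

end Summit.QuantumFields.BalabanUV.Beta.GAN24.StencilSlotWallThree

end
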